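import Literature.AlgebraicGeometry.Resolution.RidgePerfectField
import HarnessLib

/-!
# [OURS · L1 W4.2] RATIONAL points of Giraud's ridge are points of the directrix, over EVERY field:
# `v ∈ F(C)(k) ⟹ ℓ(v) = 0` for every linear form `ℓ` of the directrix space `𝒯(J)` (campaign s42, cell res-hironaka;
# informal crux `RidgeConfinement`, stmt-ResolutionOfSingularities-17845; `--supports`)

HONEST FRAMING. OURS (slot W4.2, prover res-L1-s42-pv-1, gen 6). [OURS · L1 W4.2] replaces the role of nothing printed in
H. Hironaka's manuscript. CJS's obstruction O1 («Thm. 3.14 needs `char κ(x) = 0` or `≥ dim X/2 + 1`»; Hironaka's quadric) concerns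
near points whose residue field is an INSEPARABLE extension of `κ(x)`. For `k`-RATIONAL points there is no obstruction, in any
characteristic and over any (imperfect) field `k`: a `k`-point `v` of the ridge `F` of the cone `C = V(J)` spans a LINE inside `F`
(the ridge is a cone: `smul_mem_ridge'`), i.e. the generic point `X_{i₀} · v` of the line is a point of Giraud's functor; after a
linear change of coordinates this is the coordinate point of a coordinate axis, which DIRECTS `J` (tree: BHM Prop. 2.1 / CJS
Lemma 2.7, `directs_span_X_compl_of_coordPoint_mem_ridge`); hence the directrix space `𝒯(J)` consists of linear forms vanishing at
`v`:

* `mem_ridge_map_coordChangeEquiv'`, `aeval_coordChangeEquiv'` — transport of ridge points / of evaluation under the tree's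
  `coordChangeEquiv` (re-derived: the tree's versions in `RidgePerfectField.lean` are private);
* **`aeval_eq_zero_of_mem_ridge_of_mem_directrixSpace`** — `J` homogeneous, `v ∈ F(J)(k)`, `ℓ ∈ 𝒯(J)` ⟹ `ℓ(v) = 0`.

NOT a statement of H. Hironaka's manuscript [Hironaka2017]. AI review is weaker than expert review. References (orientation
only): J. Giraud, *Bull. Sci. Math.* 99 (1975) §1.5; J. Berthomieu, P. Hivert, H. Mourtada, Prop. 2.1; V. Cossart, U. Jannsen,
S. Saito, LNM 2270 (2020), Lemma 2.7, Thm. 3.14, §1.3 (O1).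
-/

noncomputable section

-- single-conjunct summit: the doubled namespace component `ResolutionOfSingularities` is mandated
set_option linter.dupNamespace false

open MvPolynomial Module
open Literature.RingTheory.MvPolynomial
open Literature.AlgebraicGeometry.Resolution

namespace Summit.ResolutionOfSingularities.ResolutionOfSingularities.Theorems

namespace CampaignW42

universe u v

/-! ## Transport under a linear change of coordinates (re-derived from the tree's private lemmas) -/

section Transport

variable {K : Type u} [Field K] {n : ℕ} (b : Module.Basis (Fin n) K (Fin n → K))
variable {k' : Type v} [CommRing k'] [Algebra K k']

/-- Shifts fix constants. [folklore] -/
private theorem shift_C'' (v : Fin n → k') (c : k') : shift v (C c : MvPolynomial (Fin n) k') = C c := by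
  rw [shift, aeval_C, MvPolynomial.algebraMap_eq]

/-- `coordChangeEquiv b` fixes constants. [folklore] -/
theorem coordChangeEquiv_C' (a : K) : coordChangeEquiv b (C a) = C a :=
  (coordChangeEquiv b).commutes a

/-- `coordChangeEquiv b` on variables: `X_i ↦ Σ_j M_{ij} X_j`, `M_{ij} = b^*_j(e_i)`. [folklore] -/
theorem coordChangeEquiv_X' (i : Fin n) :
    coordChangeEquiv b (X i) = ∑ j, (b.repr (Pi.single i 1)) j • (X j : MvPolynomial (Fin n) K) := by
  rw [coordChangeEquiv_apply, coordChange, aeval_X, linForm_apply]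

/-- `θ(X_i) ⊗ 1 = Σ_j M_{ij} X_j` in `k'[X]`. [folklore] -/
private theorem map_coordChangeEquiv_X' (i : Fin n) :
    MvPolynomial.map (algebraMap K k') (coordChangeEquiv b (X i)) =
      ∑ j, C (algebraMap K k' ((b.repr (Pi.single i 1)) j)) * (X j : MvPolynomial (Fin n) k') := by
  rw [coordChangeEquiv_X', map_sum]
  refine Finset.sum_congr rfl fun j _ => ?_
  rw [smul_eq_C_mul, map_mul, map_C, map_X]

/-- `Θ(f ⊗ 1) = θ(f) ⊗ 1` for the base change `Θ` of `coordChangeEquiv b` to `k'[X]`. [folklore] -/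
private theorem aeval_coordMatrix_map' (f : MvPolynomial (Fin n) K) :
    aeval (fun i => ∑ j, C (algebraMap K k' ((b.repr (Pi.single i 1)) j)) * (X j : MvPolynomial (Fin n) k'))
        (MvPolynomial.map (algebraMap K k') f) =
      MvPolynomial.map (algebraMap K k') (coordChangeEquiv b f) := by
  induction f using MvPolynomial.induction_on with
  | C a => rw [map_C, aeval_C, coordChangeEquiv_C', map_C, MvPolynomial.algebraMap_eq]
  | add p q hp hq => rw [map_add, map_add, hp, hq, map_add, map_add]
  | mul_X p i hp =>
    rw [map_mul, map_X, map_mul, aeval_X, hp, map_mul, map_mul, map_coordChangeEquiv_X']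

/-- `L_v(Θ X_i) = Θ X_i + (Mv)_i`. [folklore] -/
private theorem shift_coordMatrix_X' (v : Fin n → k') (i : Fin n) :
    shift v (∑ j, C (algebraMap K k' ((b.repr (Pi.single i 1)) j)) * (X j : MvPolynomial (Fin n) k')) =
      (∑ j, C (algebraMap K k' ((b.repr (Pi.single i 1)) j)) * (X j : MvPolynomial (Fin n) k')) +
        C (∑ j, algebraMap K k' ((b.repr (Pi.single i 1)) j) * v j) := by
  have hterm : ∀ j ∈ (Finset.univ : Finset (Fin n)),
      shift v (C (algebraMap K k' ((b.repr (Pi.single i 1)) j)) * (X j : MvPolynomial (Fin n) k')) =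
        C (algebraMap K k' ((b.repr (Pi.single i 1)) j)) * X j +
          C (algebraMap K k' ((b.repr (Pi.single i 1)) j) * v j) := by
    intro j _
    rw [map_mul, shift_C'', shift_X, mul_add, C_mul]
  rw [map_sum, Finset.sum_congr rfl hterm, Finset.sum_add_distrib, map_sum]

/-- `L_v ∘ Θ = Θ ∘ L_{Mv}` with `(Mv)_i = Σ_j M_{ij} v_j`. [folklore] -/
private theorem shift_aeval_coordMatrix' (v : Fin n → k') (g : MvPolynomial (Fin n) k') :
    shift v (aeval (fun i => ∑ j, C (algebraMap K k' ((b.repr (Pi.single i 1)) j)) *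
        (X j : MvPolynomial (Fin n) k')) g) =
      aeval (fun i => ∑ j, C (algebraMap K k' ((b.repr (Pi.single i 1)) j)) * (X j : MvPolynomial (Fin n) k'))
        (shift (fun i => ∑ j, algebraMap K k' ((b.repr (Pi.single i 1)) j) * v j) g) := by
  induction g using MvPolynomial.induction_on with
  | C a => rw [aeval_C, MvPolynomial.algebraMap_eq, shift_C'', shift_C'', aeval_C, MvPolynomial.algebraMap_eq]
  | add p q hp hq => rw [map_add, map_add, hp, hq, map_add, map_add]
  | mul_X p i hp =>
    rw [map_mul, aeval_X, map_mul, hp, shift_coordMatrix_X', map_mul, shift_X, map_mul, map_add, aeval_X,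
      aeval_C, MvPolynomial.algebraMap_eq]

/-- **`θ(f)(w) = f(Mw)`**: evaluating the transformed polynomial is evaluating at the transformed point. [folklore] -/
theorem aeval_coordChangeEquiv' (w : Fin n → k') (f : MvPolynomial (Fin n) K) :
    aeval w (coordChangeEquiv b f) = aeval (fun i => ∑ j, algebraMap K k' ((b.repr (Pi.single i 1)) j) * w j) f := by
  induction f using MvPolynomial.induction_on with
  | C a => rw [coordChangeEquiv_C', aeval_C, aeval_C]
  | add p q hp hq => rw [map_add, map_add, hp, hq, map_add]
  | mul_X p i hp =>
    have hX : aeval w (coordChangeEquiv b (X i)) = ∑ j, algebraMap K k' ((b.repr (Pi.single i 1)) j) * w j := by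
      rw [coordChangeEquiv_X', map_sum]
      refine Finset.sum_congr rfl fun j _ => ?_
      rw [map_smul, aeval_X, Algebra.smul_def]
    rw [map_mul, map_mul, hp, hX, map_mul, aeval_X]

/-- **Ridge points transport**: if `Mw ∈ F_I(k')` then `w ∈ F_{θ(I)}(k')` for `θ = coordChangeEquiv b`,
`(Mw)_i = Σ_j M_{ij} w_j`. [folklore] -/
theorem mem_ridge_map_coordChangeEquiv' {I : Ideal (MvPolynomial (Fin n) K)} {w : Fin n → k'}
    (hw : (fun i => ∑ j, algebraMap K k' ((b.repr (Pi.single i 1)) j) * w j) ∈ ridge k' I) :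
    w ∈ ridge k' (I.map (coordChangeEquiv b : MvPolynomial (Fin n) K →+* MvPolynomial (Fin n) K)) := by
  rw [mem_ridge_iff_forall_mem]
  intro f' hf'
  obtain ⟨f, hf, rfl⟩ := (Ideal.mem_map_iff_of_surjective
    (coordChangeEquiv b : MvPolynomial (Fin n) K →+* MvPolynomial (Fin n) K) (coordChangeEquiv b).surjective).mp hf'
  have hcone : coneIdeal k' (I.map (coordChangeEquiv b : MvPolynomial (Fin n) K →+* MvPolynomial (Fin n) K)) =
      (coneIdeal k' I).map (aeval (R := k') fun i => ∑ j, C (algebraMap K k' ((b.repr (Pi.single i 1)) j)) *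
        (X j : MvPolynomial (Fin n) k')).toRingHom := by
    rw [coneIdeal, coneIdeal, Ideal.map_map, Ideal.map_map]
    congr 1
    refine RingHom.ext fun g => ?_
    show MvPolynomial.map (algebraMap K k') (coordChangeEquiv b g) =
      aeval (fun i => ∑ j, C (algebraMap K k' ((b.repr (Pi.single i 1)) j)) * (X j : MvPolynomial (Fin n) k'))
        (MvPolynomial.map (algebraMap K k') g)
    exact (aeval_coordMatrix_map' b g).symm
  show shift w (MvPolynomial.map (algebraMap K k') (coordChangeEquiv b f)) ∈ _
  rw [← aeval_coordMatrix_map', shift_aeval_coordMatrix', hcone]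
  exact Ideal.mem_map_of_mem _ (mem_ridge_iff_forall_mem.mp hw f hf)

end Transport

/-! ## Rational ridge points are directrix points -/

section Rational

variable {K : Type u} [Field K] {n : ℕ}

/-- **A basis of `Kⁿ` whose `i₀`-th coordinate functional is `x ↦ Σ_i v_i x_i`** (`v_{i₀} ≠ 0`). [folklore] -/
theorem exists_basis_repr_eq (v : Fin n → K) (i₀ : Fin n) (hv : v i₀ ≠ 0) :
    ∃ b : Module.Basis (Fin n) K (Fin n → K), ∀ i, (b.repr (Pi.single i 1)) i₀ = v i := by
  classical
  -- `ψ x = (…, x_j, …, Σ v_i x_i [at i₀], …)` and its inverse `ψ'`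
  let dot : (Fin n → K) →ₗ[K] K := ∑ i, v i • (LinearMap.proj i : (Fin n → K) →ₗ[K] K)
  have hdot : ∀ x : Fin n → K, dot x = ∑ i, v i * x i := fun x => by
    simp only [dot, LinearMap.coe_sum, Finset.sum_apply, LinearMap.smul_apply, LinearMap.coe_proj,
      Function.eval, smul_eq_mul]
  let ψ : (Fin n → K) →ₗ[K] (Fin n → K) := LinearMap.pi fun j => if j = i₀ then dot else LinearMap.proj j
  have hψ : ∀ x j, ψ x j = if j = i₀ then ∑ i, v i * x i else x j := fun x j => by
    change (if j = i₀ then dot else LinearMap.proj j) x = _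
    split_ifs with h
    · exact hdot x
    · rfl
  let corr : (Fin n → K) →ₗ[K] K :=
    (v i₀)⁻¹ • ((LinearMap.proj i₀ : (Fin n → K) →ₗ[K] K) - ∑ i ∈ Finset.univ.erase i₀, v i • (LinearMap.proj i : (Fin n → K) →ₗ[K] K))
  have hcorr : ∀ c : Fin n → K, corr c = (v i₀)⁻¹ * (c i₀ - ∑ i ∈ Finset.univ.erase i₀, v i * c i) := fun c => by
    simp only [corr, LinearMap.smul_apply, LinearMap.sub_apply, LinearMap.coe_sum, Finset.sum_apply, LinearMap.coe_proj,
      Function.eval, smul_eq_mul]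
  let ψ' : (Fin n → K) →ₗ[K] (Fin n → K) := LinearMap.pi fun j => if j = i₀ then corr else LinearMap.proj j
  have hψ' : ∀ c j, ψ' c j = if j = i₀ then (v i₀)⁻¹ * (c i₀ - ∑ i ∈ Finset.univ.erase i₀, v i * c i) else c j :=
    fun c j => by
    change (if j = i₀ then corr else LinearMap.proj j) c = _
    split_ifs with h
    · exact hcorr c
    · rfl
  have hsplit : ∀ x : Fin n → K, ∑ i, v i * x i = v i₀ * x i₀ + ∑ i ∈ Finset.univ.erase i₀, v i * x i := fun x => by
    rw [← Finset.add_sum_erase _ _ (Finset.mem_univ i₀)]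
  have h1 : ∀ x, ψ' (ψ x) = x := fun x => by
    funext j
    rw [hψ']
    by_cases hj : j = i₀
    · subst hj
      rw [if_pos rfl, hψ, if_pos rfl]
      have hsum : ∑ i ∈ Finset.univ.erase j, v i * ψ x i = ∑ i ∈ Finset.univ.erase j, v i * x i :=
        Finset.sum_congr rfl fun i hi => by rw [hψ, if_neg (Finset.ne_of_mem_erase hi)]
      rw [hsum, hsplit x, add_sub_cancel_right, ← mul_assoc, inv_mul_cancel₀ hv, one_mul]
    · rw [if_neg hj, hψ, if_neg hj]
  have h2 : ∀ c, ψ (ψ' c) = c := fun c => by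
    funext j
    rw [hψ]
    by_cases hj : j = i₀
    · subst hj
      rw [if_pos rfl, hsplit, hψ', if_pos rfl]
      have hsum : ∑ i ∈ Finset.univ.erase j, v i * ψ' c i = ∑ i ∈ Finset.univ.erase j, v i * c i :=
        Finset.sum_congr rfl fun i hi => by rw [hψ', if_neg (Finset.ne_of_mem_erase hi)]
      rw [hsum, ← mul_assoc, mul_inv_cancel₀ hv, one_mul, sub_add_cancel]
    · rw [if_neg hj, hψ', if_neg hj]
  let Ψ : (Fin n → K) ≃ₗ[K] (Fin n → K) :=
    LinearEquiv.ofLinear ψ ψ' (LinearMap.ext h2) (LinearMap.ext h1)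
  refine ⟨(Pi.basisFun K (Fin n)).map Ψ.symm, fun i => ?_⟩
  rw [Module.Basis.map_repr, LinearEquiv.symm_symm, LinearEquiv.trans_apply, Pi.basisFun_repr]
  change ψ (Pi.single i 1) i₀ = v i
  rw [hψ, if_pos rfl, Finset.sum_eq_single i]
  · rw [Pi.single_eq_same, mul_one]
  · intro l _ hl; rw [Pi.single_eq_of_ne hl, mul_zero]
  · intro h; exact absurd (Finset.mem_univ i) h

/-- **RATIONAL POINTS OF THE RIDGE ARE POINTS OF THE DIRECTRIX — every field, every characteristic.** For a homogeneous
ideal `J ⊆ k[X_1, …, X_n]`, a `k`-rational point `v ∈ F(J)(k)` of Giraud's ridge and a linear form `ℓ` of the directrix space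
`𝒯(J)`: `ℓ(v) = 0`, i.e. `v ∈ Dir_k(J)(k)`. (The line `k · v` lies in the cone `F`; its generic point directs `J` after a change of
coordinates; cf. CJS §1.3 (O1): the characteristic obstruction of Thm. 3.14 is invisible at rational points.)
[cite: Giraud1975, §1.5] [cite: CossartJannsenSaito2020, Lemma 2.7, Thm. 3.14] -/
theorem aeval_eq_zero_of_mem_ridge_of_mem_directrixSpace {J : Ideal (MvPolynomial (Fin n) K)}
    (hJ : ∀ f ∈ J, ∀ d : ℕ, homogeneousComponent d f ∈ J)
    {v : Fin n → K} (hv : v ∈ ridge K J) {ℓ : MvPolynomial (Fin n) K} (hℓ : ℓ ∈ directrixSpace J) :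
    aeval v ℓ = 0 := by
  classical
  have hℓ1 : ℓ.IsHomogeneous 1 := (mem_homogeneousSubmodule _ _).mp (directrixSpace_le_one J hℓ)
  by_cases hv0 : v = 0
  · -- a linear form vanishes at the origin
    subst hv0
    have h := (isAdditive_of_isHomogeneous_one hℓ1).constantCoeff_eq_zero
    rw [show (aeval (0 : Fin n → K) : MvPolynomial (Fin n) K →ₐ[K] K) = (aeval 0) from rfl, MvPolynomial.aeval_zero] at *
    exact h
  obtain ⟨i₀, hi₀⟩ : ∃ i₀, v i₀ ≠ 0 := by
    by_contra h
    push Not at h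
    exact hv0 (funext h)
  obtain ⟨b, hb⟩ := exists_basis_repr_eq v i₀ hi₀
  -- the generic point `X_{i₀} · v` of the line `k · v` lies in the ridge (the ridge is a cone)
  have hline : (fun i => (X i₀ : MvPolynomial (Fin n) K) * C (v i)) ∈ ridge (MvPolynomial (Fin n) K) J := by
    have h1 : (fun i => algebraMap K (MvPolynomial (Fin n) K) (v i)) ∈ ridge (MvPolynomial (Fin n) K) J :=
      map_mem_ridge (Algebra.ofId K (MvPolynomial (Fin n) K)) hv
    have h2 := smul_mem_ridge' hJ (X i₀ : MvPolynomial (Fin n) K) h1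
    have heq : ((X i₀ : MvPolynomial (Fin n) K) • fun i => algebraMap K (MvPolynomial (Fin n) K) (v i)) =
        fun i => (X i₀ : MvPolynomial (Fin n) K) * C (v i) := by
      funext i
      rw [Pi.smul_apply, smul_eq_mul, MvPolynomial.algebraMap_eq]
    rw [heq] at h2
    exact h2
  -- in the coordinates `b` it is the coordinate point of the axis `i₀`
  have hpt : (fun i => ∑ j, algebraMap K (MvPolynomial (Fin n) K) ((b.repr (Pi.single i 1)) j) *
      (fun j => if j ∈ ({i₀} : Finset (Fin n)) then (X j : MvPolynomial (Fin n) K) else 0) j) =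
      fun i => (X i₀ : MvPolynomial (Fin n) K) * C (v i) := by
    funext i
    rw [Finset.sum_eq_single i₀]
    · simp only [Finset.mem_singleton, if_true]
      rw [hb i, MvPolynomial.algebraMap_eq, mul_comm]
    · intro j _ hj
      simp only [Finset.mem_singleton]
      rw [if_neg hj, mul_zero]
    · intro h; exact absurd (Finset.mem_univ i₀) h
  have hcoord : (fun j => if j ∈ ({i₀} : Finset (Fin n)) then (X j : MvPolynomial (Fin n) K) else 0) ∈
      ridge (MvPolynomial (Fin n) K)
        (J.map (coordChangeEquiv b : MvPolynomial (Fin n) K →+* MvPolynomial (Fin n) K)) := by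
    apply mem_ridge_map_coordChangeEquiv' b
    rw [hpt]
    exact hline
  -- so the hyperplane forms `X_j`, `j ≠ i₀`, direct `θ(J)`, and `θ(ℓ)` lies in their span
  have hdir := directs_span_X_compl_of_coordPoint_mem_ridge ({i₀} : Finset (Fin n)) hcoord
  have hθℓ : coordChangeEquiv b ℓ ∈
      directrixSpace (J.map (coordChangeEquiv b : MvPolynomial (Fin n) K →+* MvPolynomial (Fin n) K)) := by
    -- `θ⁻¹(𝒯(θ J))` directs `J`, hence contains `𝒯(J)`
    have h := (directs_directrixSpace (J.map (coordChangeEquiv b : MvPolynomial (Fin n) K →+* MvPolynomial (Fin n) K))).map_algEquiv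
      (coordChangeEquiv b).symm (fun f hf => isHomogeneous_one_coordChangeEquiv_symm b hf)
    rw [map_map_symm_algEquiv] at h
    obtain ⟨g, hg, hgℓ⟩ := Submodule.mem_map.mp (directrixSpace_le h hℓ)
    have hθg : coordChangeEquiv b ℓ = g := by
      have h3 : (coordChangeEquiv b).symm g = ℓ := hgℓ
      rw [← h3]
      exact (coordChangeEquiv b).apply_symm_apply g
    rw [hθg]
    exact hg
  have hspan := directrixSpace_le hdir hθℓ
  -- evaluate `θ(ℓ)` at `e_{i₀}`: zero on the span, and `= ℓ(v)` by transport
  have hzero : aeval (Pi.single i₀ (1 : K)) (coordChangeEquiv b ℓ) = 0 := by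
    refine Submodule.span_induction (p := fun f _ => aeval (Pi.single i₀ (1 : K)) f = 0) ?_ ?_ ?_ ?_ hspan
    · rintro _ ⟨j, hj, rfl⟩
      have hj' : j ≠ i₀ := by
        rw [Finset.coe_compl, Set.mem_compl_iff, Finset.coe_singleton, Set.mem_singleton_iff] at hj
        exact hj
      rw [aeval_X, Pi.single_eq_of_ne hj']
    · exact map_zero _
    · intro x y _ _ hx hy; rw [map_add, hx, hy, add_zero]
    · intro c x _ hx; rw [map_smul, hx, smul_zero]
  have hv' : (fun i => ∑ j, algebraMap K K ((b.repr (Pi.single i 1)) j) * (Pi.single i₀ (1 : K) : Fin n → K) j) = v := by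
    funext i
    rw [Finset.sum_eq_single i₀]
    · rw [Pi.single_eq_same, mul_one, Algebra.algebraMap_self, RingHom.id_apply, hb i]
    · intro j _ hj; rw [Pi.single_eq_of_ne hj, mul_zero]
    · intro h; exact absurd (Finset.mem_univ i₀) h
  have htrans : aeval (Pi.single i₀ (1 : K)) (coordChangeEquiv b ℓ) = aeval v ℓ := by
    rw [aeval_coordChangeEquiv', hv']
  rw [← htrans]
  exact hzero

end Rational

end CampaignW42

end Summit.ResolutionOfSingularities.ResolutionOfSingularities.Theorems

end
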